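import Literature.MathematicalPhysics.QuantumFieldTheory.Balaban1983to89.TreeLengthTorus
import Mathlib.Analysis.Calculus.FDeriv.Add
import HarnessLib

/-!
# ADDITIVE CLOSURE OF LOCALIZED ANALYTIC FAMILIES (POLYᵃ∘'s clauses are stable under `T₁ + T₂`; abstract, def-free)

Cell `ym3-torus` (YM ladder rung R3 = continuum `SU(2)` Yang–Mills on the three-torus — a RUNG, NOT d = 4, NOT infinite volume, NOT a mass gap, NOT Clay).  Width seat
`ym-ust-20520-w3` (gen 20, LEAD-20520 by lineage); `--supports stmt-QuantumFields-20520 --as helper`, count-neutral, definition-free, default heartbeats.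

WHAT.  The analytic edition POLYᵃ∘ of LINE g24-3's polymer form (✓`…PolymerAnalyticKnit`) asks ONE localized family `T : Finset (TPt 3 N) → (configurations) → ℝ` with
(i) locality through a cube map, (ii) support on face-connected polymers, (iii) bounded analytic one-coordinate interpolations, (iv) a representation of the fluctuation part
as `c₀ + Σ_Y T Y`.  Print delivers the fluctuation part as a SUM of such families — the small-field terms `E^{(j)}(X)` ([Balaban1987RG1] (0.23)–(0.25) p.257), the
`R′`-terms ([Balaban1989LargeFieldII] (1.98)–(1.100) p.390), and the localized logarithm of the large-field strata gas (✓`…PolymerMayerGas.exists_localized_log_gas`, the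
last Mayer step).  This file is the bookkeeping that lets a consumer ADD them: ★★ `localizedAnalytic_add` — if `T₁` and `T₂` satisfy (i)(ii)(iii) on the same window `S`,
the same disc `ball 0 Rad` and the same decay profile `m Y`, with constants `B₁`, `B₂`, then `T₁ + T₂` satisfies (i)(ii)(iii) with constant `B₁ + B₂` (interpolants add:
`DifferentiableOn.add`, `norm_add_le`), and (iv) adds by `Finset.sum_add_distrib` (`sum_add_pointwise`).  Abstract over the configuration type `ι → G`, the cube map
`q : ι → TPt d N` and the profile `m`; no Bałaban object.
Consumer: w4-20520's (F) «POLY-GAS-KNIT» (BAL-GAS∘ → POLYᵃ∘ through (E) ⊕ this file).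

HONEST SCOPE.  Finite-sum∕calculus bookkeeping; nothing of Bałaban's is asserted or proved; POLYᵃ∘ ∕ POLY∘ ∕ S2β ∕ `FluctuationComparisonRegPrIntL` (20520) NOT proved; no summit is
proved by a helper; rung R3 = SU(2) YM₃ on T³ — NOT d = 4, NOT infinite volume, NOT a mass gap, NOT Clay.  Sorry-free, axioms standard.

References: T. Bałaban, CMP **109** (1987) 249–301 [Balaban1987RG1] ((0.23)–(0.25) p.257, (1.11)–(1.14) p.262); CMP **122** (1989) 355–392 [Balaban1989LargeFieldII]
((1.98)–(1.100) p.390); CMP **116** (1988) 1–22 [Balaban1988RG2Cluster] ((2.13) p.14).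
-/

set_option autoImplicit false

noncomputable section

namespace Summit.QuantumFields.YangMills.Theorems.FluctuationComparisonRegPrIntLPolymerAnalyticAdd

open scoped BigOperators
open Literature.MathematicalPhysics.QuantumFieldTheory.Balaban1983to89.TreeLengthTorus (TPt TFaceConnected)

variable {d N : ℕ} [NeZero N]

/-- (iv) adds: `Σ_Y (T₁ Y U + T₂ Y U) = Σ_Y T₁ Y U + Σ_Y T₂ Y U`. [folklore] -/
theorem sum_add_pointwise {ι G : Type*} (T₁ T₂ : Finset (TPt d N) → (ι → G) → ℝ) (U : ι → G) :
    ∑ Y : Finset (TPt d N), (T₁ Y U + T₂ Y U) = (∑ Y : Finset (TPt d N), T₁ Y U) + ∑ Y : Finset (TPt d N), T₂ Y U :=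
  Finset.sum_add_distrib

omit [NeZero N] in
/-- ★★ **LOCALIZED ANALYTIC FAMILIES ADD.**  Two families `T₁, T₂ : Finset (TPt d N) → (ι → G) → ℝ` with (i) locality through the cube map `q`, (ii) support on
face-connected polymers, (iii) for every one-coordinate move inside the window `S` and every polymer `Y` an interpolation complex-differentiable on `ball 0 Rad`, bounded there
by `Bₖ · m Y`, with boundary values `Tₖ Y U`, `Tₖ Y V` — have a SUM `Y U ↦ T₁ Y U + T₂ Y U` with (i), (ii) and (iii) at the constant `B₁ + B₂` (same `Rad`, same profile `m`).
[cite: Balaban1987RG1, (0.23)-(0.25) p.257; Balaban1989LargeFieldII, (1.98)-(1.100) p.390; Balaban1988RG2Cluster, (2.13) p.14] -/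
theorem localizedAnalytic_add {ι G : Type*} (q : ι → TPt d N) (S : Set (ι → G)) (m : Finset (TPt d N) → ℝ) {Rad B₁ B₂ : ℝ}
    (T₁ T₂ : Finset (TPt d N) → (ι → G) → ℝ)
    (h₁loc : ∀ Y U V, (∀ i, q i ∈ Y → U i = V i) → T₁ Y U = T₁ Y V)
    (h₂loc : ∀ Y U V, (∀ i, q i ∈ Y → U i = V i) → T₂ Y U = T₂ Y V)
    (h₁supp : ∀ Y, ¬ TFaceConnected Y → ∀ U, T₁ Y U = 0)
    (h₂supp : ∀ Y, ¬ TFaceConnected Y → ∀ U, T₂ Y U = 0)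
    (h₁an : ∀ (i : ι) (U V : ι → G), U ∈ S → V ∈ S → (∀ j, j ≠ i → U j = V j) → ∀ Y : Finset (TPt d N),
      ∃ g : ℂ → ℂ, DifferentiableOn ℂ g (Metric.ball 0 Rad) ∧ (∀ z ∈ Metric.ball (0 : ℂ) Rad, ‖g z‖ ≤ B₁ * m Y) ∧
        g 0 = (T₁ Y U : ℂ) ∧ g 1 = (T₁ Y V : ℂ))
    (h₂an : ∀ (i : ι) (U V : ι → G), U ∈ S → V ∈ S → (∀ j, j ≠ i → U j = V j) → ∀ Y : Finset (TPt d N),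
      ∃ g : ℂ → ℂ, DifferentiableOn ℂ g (Metric.ball 0 Rad) ∧ (∀ z ∈ Metric.ball (0 : ℂ) Rad, ‖g z‖ ≤ B₂ * m Y) ∧
        g 0 = (T₂ Y U : ℂ) ∧ g 1 = (T₂ Y V : ℂ)) :
    (∀ Y U V, (∀ i, q i ∈ Y → U i = V i) → T₁ Y U + T₂ Y U = T₁ Y V + T₂ Y V) ∧
    (∀ Y, ¬ TFaceConnected Y → ∀ U, T₁ Y U + T₂ Y U = 0) ∧
    (∀ (i : ι) (U V : ι → G), U ∈ S → V ∈ S → (∀ j, j ≠ i → U j = V j) → ∀ Y : Finset (TPt d N),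
      ∃ g : ℂ → ℂ, DifferentiableOn ℂ g (Metric.ball 0 Rad) ∧ (∀ z ∈ Metric.ball (0 : ℂ) Rad, ‖g z‖ ≤ (B₁ + B₂) * m Y) ∧
        g 0 = ((T₁ Y U + T₂ Y U : ℝ) : ℂ) ∧ g 1 = ((T₁ Y V + T₂ Y V : ℝ) : ℂ)) := by
  refine ⟨fun Y U V h => by rw [h₁loc Y U V h, h₂loc Y U V h], fun Y hY U => by rw [h₁supp Y hY U, h₂supp Y hY U, add_zero], ?_⟩
  intro i U V hU hV hUV Y
  obtain ⟨g₁, hg₁, hb₁, h₁0, h₁1⟩ := h₁an i U V hU hV hUV Y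
  obtain ⟨g₂, hg₂, hb₂, h₂0, h₂1⟩ := h₂an i U V hU hV hUV Y
  refine ⟨fun z => g₁ z + g₂ z, hg₁.add hg₂, fun z hz => ?_, ?_, ?_⟩
  · calc ‖g₁ z + g₂ z‖ ≤ ‖g₁ z‖ + ‖g₂ z‖ := norm_add_le _ _
      _ ≤ B₁ * m Y + B₂ * m Y := add_le_add (hb₁ z hz) (hb₂ z hz)
      _ = (B₁ + B₂) * m Y := by ring
  · show g₁ 0 + g₂ 0 = _
    rw [h₁0, h₂0, Complex.ofReal_add]
  · show g₁ 1 + g₂ 1 = _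
    rw [h₁1, h₂1, Complex.ofReal_add]

/-- **THE SAME WITH A CONSTANT TERM** (print's `c₀`'s add too): the representation clause of a sum of two fluctuation parts `c₁ + Σ T₁` and `c₂ + Σ T₂` is
`(c₁ + c₂) + Σ (T₁ + T₂)`. [folklore] -/
theorem repr_add {ι G : Type*} (T₁ T₂ : Finset (TPt d N) → (ι → G) → ℝ) {f₁ f₂ : (ι → G) → ℝ} {c₁ c₂ : ℝ} {S : Set (ι → G)}
    (h₁ : ∀ U ∈ S, f₁ U = c₁ + ∑ Y : Finset (TPt d N), T₁ Y U) (h₂ : ∀ U ∈ S, f₂ U = c₂ + ∑ Y : Finset (TPt d N), T₂ Y U) :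
    ∀ U ∈ S, f₁ U + f₂ U = (c₁ + c₂) + ∑ Y : Finset (TPt d N), (T₁ Y U + T₂ Y U) := by
  intro U hU
  rw [h₁ U hU, h₂ U hU, Finset.sum_add_distrib]
  ring

end Summit.QuantumFields.YangMills.Theorems.FluctuationComparisonRegPrIntLPolymerAnalyticAdd

end
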